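/-
Copyright (c) 2026 the pub-hodgecm-mathlib formalisation cell (harness21).  Prover seat hodgecm-mathlib-LH4-p16 (g2), req620 Track A «(D-RAM) FOUR-FRAME» squad
(STAGE-1b, row (2) of the piece `f_{T₊}`, the (β₂) road (R-36); β₂ sub-dealer LH4-p04 (g9) «= ROAD K5∕K6»; LH4-p19 (g2)'s COUNT SOCKET hypothesis (hP); MECH-K3 v1 §2
«population ⟺ ω(t)»), 2026-09-05.
-/
import Summits.HodgeConjecture.HodgeConjecture.Theorems.F0P3cDyRamRowCellPopulationHalves        -- ★ p863565 (this seat): `exists_fixed_normTheta_mul_iff_not`; brings ★ p863477 `trace_letters`, `dualGen_sub_map_eq`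
import Summits.HodgeConjecture.HodgeConjecture.Theorems.F0P3cDyRamThetaNormClassReciprocity     -- ★ p863223 (this seat): `normTheta_mul_map_normTheta`
import Literature.NumberTheory.LocalFields.WildQuadraticDatumNormFibreValuesAbove                 -- ★ Lit: `natCard_normFibre_eq_two_mul_pow_of_exists`, `natCard_normFibre_eq_zero_of_not_exists_of_le`
import Literature.NumberTheory.LocalFields.WildQuadraticDatumNormSignConductor                   -- ★ Lit: `normSign_mul_of_fixed`; brings ★ `normSign`, `normSign_of_isNorm`, `normSign_of_not_isNorm`
import HarnessLib

/-!
# Crux `H413`, line LH4 «(D-RAM) FOUR-FRAME» — STAGE-1b, row (2), the (β₂) road (R-36), (ROW-INT) ∕ ‹CORE›: «THE POPULATION READ OF A ROW VERTEX» — the weight `f b j Λ` is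
# non-zero iff the population scalar `t = Tr_ρ(h·x₀Θx₀)` lies in ONE prescribed `E∕F`-norm class (LH4-p19 (g2)'s COUNT SOCKET hypothesis (hP), CELLREAD-C.sig.v1)

Cell `hodgecm-mathlib` (D-0151), FLOOR 0, crux item H413 = `stmt-HodgeConjecture-24833`, route of record `HCCMUnconditional`; squad F0∕P3c∕LH4; lane
`--supports stmt-HodgeConjecture-24833 --as helper` (count-neutral; pays NO tier-0 row).  THEOREMS ONLY (no `def`, no instance, no notation, no `sorry`, default heartbeats);
★-only imports; states NO law; (β₂) stays a HYPOTHESIS.  One-field `M` letters (`ρ`, `Θ` commuting involutions, `jE : E → M` with `Fix ρ = jE(E)`, `Θ∘jE = jE∘σ`), the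
`E`-side wild datum (complete `E`, finite residue field, `|2| < 1`), and the WEIGHT LETTER `_hf` of ‹OFF_C›∕‹OFF› INSTANTIATED at the vertex (the value `f` and `jE r = glueUnit …`).
WHY (MECH-K3 v1 §2; `F0/P3c/LH4/LH4-p16/g2/CELLREAD-C.sig.v1.LH4p16g2.lean.txt`; LH4-p19 (g2) 00:39:49Z `cellDiff_eq_zero_of_fibration_reads`, hypothesis (hP)
`GEN Λ x₀ → (f b j Λ ≠ 0 ↔ (CLS x₀ ↔ ε))`).  The weight of a depth-cell member is the number of glue residues `#Sol_{2b}(r)`, `jE r = glueUnit`, which is `2q^b` or `0` according as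
`r` is an `E∕F`-norm or not (★ Lit, `d ≤ b`).  THIS FILE reads `r` in the `(t, κ̂)` currency: `glueUnit = −Tr_ρ(D₀⁻¹)·(ϖEΘϖE)^b∕c_U` and
**`Tr_ρ(D₀⁻¹) = t ∕ (N_ρ(u₀)·ν)`**, `u₀ = h·x₀Θx₀`, `t = Tr_ρ u₀`, `ν = N_Θ(cc(α − ρα))` (§2), with `N_ρ(u₀) = N_ρ(h)·N_Θ(x₀ρx₀)` (★ K5-C (9)); every factor except `t`, `N_ρ h`,
`N_Θ(α − ρα)`, `c_U` is the `Θ`-norm of a `ρ`-fixed element, so (§1 class calculus, norm index two = letter `hdichF`) **`f ≠ 0 ⟺ (t ∈ 𝒩 ⟺ −N_ρ(h)·N_Θ(α − ρα)·c_U ∈ 𝒩)`**,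
`𝒩 := {eΘe : ρe = e}` — p19's `(CLS x₀ ↔ ε)` with `CLS x₀ := t ∈ 𝒩` (★ p863565's class) and `ε` a LITERAL constant (`c_U ∈ {jE 1, jE η}`, `h` the literal's line scalar);
and (§4, the (hL) link) under the glue letter `D₀⁻¹ + ρD₀⁻¹ = jE pw`: `pw·(ϖσϖ)^b = −c_U·r`, so **`f ≠ 0 ⟺ ω(pw·(ϖσϖ)^b) = ω(−c_U)`** — the pairing sign is CONSTANT on the populated class.
WHAT IS NOT CLAIMED: the value of `ε` per literal (hyperbolic ∕ anisotropic; `ω(η) = −1` flips it), any count.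
HONEST LABEL.  Count-neutral; nothing printed is asserted; no census law is stated; `HC_CM` is proved only modulo the 7 printed citations (2 remaining named inputs: hLiu418 =
`stmt-HodgeConjecture-24832`, h413 = `stmt-HodgeConjecture-24833`) until rung 0 closes.
## References
* [Jacobowitz1962] R. Jacobowitz, *Hermitian forms over local fields*, Amer. J. Math. 84 (1962): §4 (gluing, the glue unit).
* [Kottwitz1986BaseChangeUnits] R. E. Kottwitz, *Base change for unit elements of Hecke algebras*, Compositio Math. 60 (1986): §1 pp. 240–241.
* [Serre1979] J.-P. Serre, *Local Fields*, GTM 67 (1979): Ch. V §3 Prop. 5, Cor. 2–3 (norm residues at and above the conductor; norm index two), Ch. XIV §6.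
* [LabesseLanglands1979] J.-P. Labesse, R. P. Langlands, *L-indistinguishability for SL(2)*, Canad. J. Math. 31 (1979): §2 p. 8.
-/

set_option autoImplicit false

noncomputable section

namespace Summit.HodgeConjecture.HodgeConjecture.Cruxes.H413.F0P3cDyRamRowVertexPopulationRead

open scoped Valued WithZero
open WithZero
open Literature.NumberTheory.Automorphic.UnitaryThreeFourFrame (IsRamifiedQuadraticDatum normSign normSign_of_isNorm normSign_of_not_isNorm)
open Literature.NumberTheory.LocalFields.WildQuadraticDatum (natCard_normFibre_eq_two_mul_pow_of_exists natCard_normFibre_eq_zero_of_not_exists_of_le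
  normSign_mul_of_fixed)
open Summit.HodgeConjecture.HodgeConjecture.Cruxes.H413.F0P3cDyRamToricCensusDefs
open Summit.HodgeConjecture.HodgeConjecture.Cruxes.H413.F0P3cDyRamThetaNormClassReciprocity (normTheta_mul_map_normTheta)
open Summit.HodgeConjecture.HodgeConjecture.Cruxes.H413.F0P3cDyRamRowCellPopulationHalves (exists_fixed_normTheta_mul_iff_not)

variable {E M : Type} [Field E] [Valued E ℤᵐ⁰] [Field M] [Valued M ℤᵐ⁰] {ρ Θ : M →+* M} {α : M}

/-! ## §1 Class calculus for `𝒩 := {eΘe : ρe = e}` -/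
omit [Valued M ℤᵐ⁰] in
/-- `𝒩` is closed under products. [cite: Serre1979, Ch. V §3] -/
theorem fixedNorm_mul {x y : M} (hx : ∃ e : M, ρ e = e ∧ e * Θ e = x) (hy : ∃ e : M, ρ e = e ∧ e * Θ e = y) :
    ∃ e : M, ρ e = e ∧ e * Θ e = x * y := by
  obtain ⟨e₁, h₁, he₁⟩ := hx; obtain ⟨e₂, h₂, he₂⟩ := hy
  exact ⟨e₁ * e₂, by rw [map_mul, h₁, h₂], by rw [map_mul, ← he₁, ← he₂]; ring⟩

omit [Valued M ℤᵐ⁰] in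
/-- `𝒩` is closed under inverses. [cite: Serre1979, Ch. V §3] -/
theorem fixedNorm_inv {x : M} (hx : ∃ e : M, ρ e = e ∧ e * Θ e = x) : ∃ e : M, ρ e = e ∧ e * Θ e = x⁻¹ := by
  obtain ⟨e, h, he⟩ := hx
  exact ⟨e⁻¹, by rw [map_inv₀, h], by rw [map_inv₀, ← mul_inv, he]⟩

omit [Valued M ℤᵐ⁰] in
/-- Multiplying by an element of `𝒩` does not change membership (`y ≠ 0`). [cite: Serre1979, Ch. V §3] -/
theorem fixedNorm_mul_iff {x y : M} (hy0 : y ≠ 0) (hy : ∃ e : M, ρ e = e ∧ e * Θ e = y) :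
    (∃ e : M, ρ e = e ∧ e * Θ e = x * y) ↔ ∃ e : M, ρ e = e ∧ e * Θ e = x := by
  refine ⟨fun h => ?_, fun h => fixedNorm_mul h hy⟩
  have h' := fixedNorm_mul h (fixedNorm_inv hy)
  rwa [mul_inv_cancel_right₀ hy0] at h'

omit [Valued M ℤᵐ⁰] in
/-- The `Θ`-norm of a `ρ`-fixed element is in `𝒩` (by definition), and so is `N_Θ(x₀ρx₀)` for any `x₀` (`ρ² = 1`). [cite: Serre1979, Ch. XIV §6] -/
theorem fixedNorm_normTheta_normRho (hρρ : ∀ x, ρ (ρ x) = x) (x₀ : M) : ∃ e : M, ρ e = e ∧ e * Θ e = (x₀ * ρ x₀) * Θ (x₀ * ρ x₀) :=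
  ⟨x₀ * ρ x₀, by rw [map_mul, hρρ, mul_comm], rfl⟩

omit [Valued E ℤᵐ⁰] [Valued M ℤᵐ⁰] in
/-- **TRANSFER THROUGH `jE`**: for `y : E`, `jE y ∈ 𝒩 ⟺ y ∈ N_{E∕F}(E^×)` (`Fix ρ = jE(E)`, `Θ∘jE = jE∘σ`, `jE` injective). [cite: Serre1979, Ch. V §3] -/
theorem fixedNorm_map_iff {σ : E →+* E} (jE : E →+* M) (hjfix : ∀ z, ρ z = z ↔ ∃ c, jE c = z) (hΘj : ∀ c, Θ (jE c) = jE (σ c)) (y : E) :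
    (∃ e : M, ρ e = e ∧ e * Θ e = jE y) ↔ ∃ z : E, z * σ z = y := by
  constructor
  · rintro ⟨e, hρe, he⟩
    obtain ⟨z, rfl⟩ := (hjfix e).1 hρe
    refine ⟨z, jE.injective ?_⟩
    rw [map_mul, ← hΘj, he]
  · rintro ⟨z, hz⟩
    exact ⟨jE z, (hjfix _).2 ⟨z, rfl⟩, by rw [hΘj, ← map_mul, hz]⟩

omit [Valued M ℤᵐ⁰] in
/-- The square of a doubly-fixed element is in `𝒩` (`c² = c·Θc`). [cite: Serre1979, Ch. V §3] -/
theorem fixedNorm_sq {c : M} (hρc : ρ c = c) (hΘc : Θ c = c) : ∃ e : M, ρ e = e ∧ e * Θ e = c * c :=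
  ⟨c, hρc, by rw [hΘc]⟩

omit [Valued M ℤᵐ⁰] in
/-- **THE INDEX-TWO STEP**: with a doubly-fixed `c ∉ 𝒩` and the dichotomy letter («`u ∈ 𝒩` or `c·u ∈ 𝒩`» for non-zero doubly-fixed `u`): for non-zero doubly-fixed `x, k`,
`x·k ∈ 𝒩 ⟺ (x ∈ 𝒩 ⟺ k ∈ 𝒩)`. [cite: Serre1979, Ch. V §3 Cor. 3] -/
theorem fixedNorm_mul_iff_iff {c x k : M} (hρc : ρ c = c) (hΘc : Θ c = c) (hcn : ¬ ∃ e : M, ρ e = e ∧ e * Θ e = c)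
    (hdich : ∀ u : M, ρ u = u → Θ u = u → u ≠ 0 → (∃ e : M, ρ e = e ∧ e * Θ e = u) ∨ ∃ e : M, ρ e = e ∧ e * Θ e = c * u)
    (hρx : ρ x = x) (hΘx : Θ x = x) (hx0 : x ≠ 0) (hρk : ρ k = k) (hΘk : Θ k = k) (hk0 : k ≠ 0) :
    (∃ e : M, ρ e = e ∧ e * Θ e = x * k) ↔ ((∃ e : M, ρ e = e ∧ e * Θ e = x) ↔ ∃ e : M, ρ e = e ∧ e * Θ e = k) := by
  by_cases hk : ∃ e : M, ρ e = e ∧ e * Θ e = k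
  · rw [fixedNorm_mul_iff hk0 hk]; exact ⟨fun h => ⟨fun _ => hk, fun _ => h⟩, fun h => h.2 hk⟩
  · have hck : ∃ e : M, ρ e = e ∧ e * Θ e = c * k := (hdich k hρk hΘk hk0).resolve_left hk
    have hc0 : c ≠ 0 := fun h0 => hcn ⟨0, map_zero ρ, by rw [h0, map_zero, mul_zero]⟩
    have e1 : x * k = (c⁻¹ * x) * (c * k) := by field_simp
    rw [e1, fixedNorm_mul_iff (mul_ne_zero hc0 hk0) hck]
    -- `c⁻¹·x ∈ 𝒩 ⟺ x ∉ 𝒩` (★ p863565's class swap with `c⁻¹`)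
    have hcinv : ¬ ∃ e : M, ρ e = e ∧ e * Θ e = c⁻¹ := fun h => hcn (by simpa using fixedNorm_inv h)
    have hsq : ∃ e : M, ρ e = e ∧ e * Θ e = c⁻¹ * c⁻¹ := fixedNorm_sq (by rw [map_inv₀, hρc]) (by rw [map_inv₀, hΘc])
    have hdichx : (∃ e : M, ρ e = e ∧ e * Θ e = x) ∨ ∃ e : M, ρ e = e ∧ e * Θ e = c⁻¹ * x := by
      rcases hdich x hρx hΘx hx0 with h1 | h2
      · exact Or.inl h1
      · refine Or.inr ?_
        have h3 := fixedNorm_mul h2 hsq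
        have e2 : c * x * (c⁻¹ * c⁻¹) = c⁻¹ * x := by field_simp
        rwa [e2] at h3
    rw [exists_fixed_normTheta_mul_iff_not hx0 hcinv hdichx]
    exact ⟨fun h => ⟨fun hx => absurd hx h, fun hk' => absurd hk' hk⟩, fun h hx => hk (h.1 hx)⟩

/-! ## §2 The glue unit in the `(t, u₀)` currency -/
omit [Valued M ℤᵐ⁰] in
/-- **`Tr_ρ(h·x₀Θx₀ ∕ (Y·ΘY)) = t ∕ (N_ρ(u₀)·ν)`**, `Y = dualGen = u₀·cc(α − ρα)`, `u₀ = h·x₀Θx₀`, `t = Tr_ρ u₀`, `ν = cc(α − ρα)·Θ(cc(α − ρα))` (`Θh = h`, `Θ² = 1`, `Θρ = ρΘ`,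
`ρcc = cc`, `ρ² = 1`; `h, x₀, cc(α − ρα) ≠ 0`). [cite: Jacobowitz1962, §4] -/
theorem trace_dualScalar_eq (hρρ : ∀ x, ρ (ρ x) = x) (hΘΘ : ∀ x, Θ (Θ x) = x) (hΘρ : ∀ x, Θ (ρ x) = ρ (Θ x))
    {cc hM x₀ : M} (hρcc : ρ cc = cc) (hΘh : Θ hM = hM) (hh : hM ≠ 0) (hx₀ : x₀ ≠ 0) (hcc : cc * (α - ρ α) ≠ 0) :
    hM * (x₀ * Θ x₀) / (dualGen ρ Θ α cc hM x₀ * Θ (dualGen ρ Θ α cc hM x₀)) + ρ (hM * (x₀ * Θ x₀) / (dualGen ρ Θ α cc hM x₀ * Θ (dualGen ρ Θ α cc hM x₀))) =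
      (hM * (x₀ * Θ x₀) + ρ (hM * (x₀ * Θ x₀))) / ((hM * (x₀ * Θ x₀)) * ρ (hM * (x₀ * Θ x₀)) * (cc * (α - ρ α) * Θ (cc * (α - ρ α)))) := by
  have hΘx₀ : Θ x₀ ≠ 0 := (map_ne_zero Θ).2 hx₀
  have hu₀ : hM * (x₀ * Θ x₀) ≠ 0 := mul_ne_zero hh (mul_ne_zero hx₀ hΘx₀)
  have hρu₀ : ρ (hM * (x₀ * Θ x₀)) ≠ 0 := (map_ne_zero ρ).2 hu₀
  have hc0 : cc ≠ 0 := fun h0 => hcc (by rw [h0, zero_mul])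
  have hA0 : α - ρ α ≠ 0 := fun h0 => hcc (by rw [h0, mul_zero])
  have hΘc0 : Θ cc ≠ 0 := (map_ne_zero Θ).2 hc0
  have hΘA0 : Θ (α - ρ α) ≠ 0 := (map_ne_zero Θ).2 hA0
  set A : M := α - ρ α with hAdef
  set u₀ : M := hM * (x₀ * Θ x₀) with hu₀def
  -- `ν` is `ρ`-fixed
  have hρν : ρ (cc * A * Θ (cc * A)) = cc * A * Θ (cc * A) := by
    have h1 : ρ (cc * A) = -(cc * A) := by rw [map_mul, hρcc, hAdef, map_sub, hρρ]; ring
    rw [map_mul, ← hΘρ, h1, map_neg]; ring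
  -- the inner quotient is `(u₀·ν)⁻¹`
  have hq : u₀ / (dualGen ρ Θ α cc hM x₀ * Θ (dualGen ρ Θ α cc hM x₀)) = (u₀ * (cc * A * Θ (cc * A)))⁻¹ := by
    rw [dualGen_def, ← hAdef, hu₀def]
    simp only [map_mul, hΘh, hΘΘ]
    field_simp
  have key : ∀ {u r n : M}, u ≠ 0 → r ≠ 0 → n ≠ 0 → (u * n)⁻¹ + (r * n)⁻¹ = (u + r) / (u * r * n) := by
    intro u r n hu hr hn; field_simp; ring
  rw [hq, map_inv₀, map_mul ρ u₀, hρν]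
  exact key hu₀ hρu₀ (mul_ne_zero hcc ((map_ne_zero Θ).2 hcc))

omit [Valued M ℤᵐ⁰] in
/-- **THE GLUE UNIT IN THE `(t, u₀)` CURRENCY**: `glueUnit = −(t ∕ (N_ρ(u₀)·ν))·(ϖEΘϖE)^a ∕ c_U`. [cite: Jacobowitz1962, §4] -/
theorem glueUnit_eq_trace_form (hρρ : ∀ x, ρ (ρ x) = x) (hΘΘ : ∀ x, Θ (Θ x) = x) (hΘρ : ∀ x, Θ (ρ x) = ρ (Θ x))
    {cc hM x₀ : M} (hρcc : ρ cc = cc) (hΘh : Θ hM = hM) (hh : hM ≠ 0) (hx₀ : x₀ ≠ 0) (hcc : cc * (α - ρ α) ≠ 0) (ϖE cU : M) (a : ℕ) :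
    glueUnit ρ Θ α cc hM ϖE cU x₀ a =
      -((hM * (x₀ * Θ x₀) + ρ (hM * (x₀ * Θ x₀))) / ((hM * (x₀ * Θ x₀)) * ρ (hM * (x₀ * Θ x₀)) * (cc * (α - ρ α) * Θ (cc * (α - ρ α)))) *
        (ϖE * Θ ϖE) ^ a / cU) := by
  rw [glueUnit_def, trace_dualScalar_eq hρρ hΘΘ hΘρ hρcc hΘh hh hx₀ hcc]

omit [Valued M ℤᵐ⁰] in
/-- **`h·x₀Θx₀ ∕ (Y·ΘY) = D₀⁻¹`**, `D₀ := cc(α − ρα)·ΘY`, `Y = dualGen ρ Θ α cc h x₀ = h·x₀Θx₀·cc(α − ρα)` (an identity of rational functions; the degenerate case `h·x₀Θx₀ = 0` reads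
`0 = 0`). [cite: Jacobowitz1962, §4] -/
theorem dualScalar_eq_inv_cellScalar (cc hM x₀ : M) :
    hM * (x₀ * Θ x₀) / (dualGen ρ Θ α cc hM x₀ * Θ (dualGen ρ Θ α cc hM x₀)) = (cc * (α - ρ α) * Θ (dualGen ρ Θ α cc hM x₀))⁻¹ := by
  rw [dualGen_def]
  by_cases hu : hM * (x₀ * Θ x₀) = 0; · simp [hu]
  rw [mul_assoc (hM * (x₀ * Θ x₀)) (cc * (α - ρ α)), div_mul_cancel_left₀ hu]

omit [Valued M ℤᵐ⁰] in
/-- **THE GLUE UNIT IN PAIRING FORM**: under the glue letter `D₀⁻¹ + ρD₀⁻¹ = T` (`D₀ = cc(α − ρα)·ΘY`; in the frame `T = jE⟨w₀, w₀⟩` for the dual vertex generator `w₀`, `φ w₀ = Y⁻¹x₀`,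
★ `inv_add_map_inv_eq_map_pairing`), `glueUnit ρ Θ α cc h ϖE c_U x₀ a = −(T·(ϖEΘϖE)^a ∕ c_U)`. [cite: Jacobowitz1962, §4] [cite: Kottwitz1986BaseChangeUnits, §1 pp. 240–241] -/
theorem glueUnit_eq_neg_trace_mul {cc hM x₀ T : M}
    (hTr : (cc * (α - ρ α) * Θ (dualGen ρ Θ α cc hM x₀))⁻¹ + ρ (cc * (α - ρ α) * Θ (dualGen ρ Θ α cc hM x₀))⁻¹ = T) (ϖE cU : M) (a : ℕ) :
    glueUnit ρ Θ α cc hM ϖE cU x₀ a = -(T * (ϖE * Θ ϖE) ^ a / cU) := by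
  rw [glueUnit_def, dualScalar_eq_inv_cellScalar, hTr]

omit [Valued E ℤᵐ⁰] [Valued M ℤᵐ⁰] in
/-- **`pw·(ϖσϖ)^b = −h_W·r`**: the glue value `r` (`jE r = glueUnit ρ Θ α cc h (jEϖ) (jE h_W) x₀ b`) and the pairing `pw` of the dual vertex generator (glue letter
`D₀⁻¹ + ρD₀⁻¹ = jE pw`) differ by the LITERAL CONSTANT `−h_W` and the norm `(ϖσϖ)^b`. [cite: Jacobowitz1962, §4] [cite: Kottwitz1986BaseChangeUnits, §1 pp. 240–241] -/
theorem pairing_mul_normPow_eq {σ : E →+* E} (jE : E →+* M) (hΘj : ∀ c, Θ (jE c) = jE (σ c)) {cc hM x₀ : M} {ϖ pw hW r : E} (hhW : hW ≠ 0)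
    (hTr : (cc * (α - ρ α) * Θ (dualGen ρ Θ α cc hM x₀))⁻¹ + ρ (cc * (α - ρ α) * Θ (dualGen ρ Θ α cc hM x₀))⁻¹ = jE pw) {b : ℕ}
    (hr : jE r = glueUnit ρ Θ α cc hM (jE ϖ) (jE hW) x₀ b) : pw * (ϖ * σ ϖ) ^ b = -hW * r := by
  apply jE.injective
  have hjhW : jE hW ≠ 0 := (map_ne_zero jE).2 hhW
  rw [map_mul, map_pow, map_mul, ← hΘj, map_mul, map_neg, hr, glueUnit_eq_neg_trace_mul hTr]
  field_simp

/-- **THE GLUE VALUE OF A ROW VERTEX IS A FIXED UNIT**: `jE r = glueUnit ρ Θ α (jEϖ^j) h (jEϖ) (jE h_W) x₀ b` at a vertex of the cell `(j, b)` (`x₀ ≠ 0`, `Y` integral, Gram-primitive, of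
level `b ≥ 1`; letter `hFgap`; `σh_W = h_W`, `|jE h_W| = 1`) forces `σ r = r` and `|r| = 1` (`t = Tr_ρ(h·x₀Θx₀)` is a doubly-fixed unit, ★ `trace_letters`; `|N_ρ(u₀)·ν| = |ϖEΘϖE|^b`).
[cite: Jacobowitz1962, §4] [cite: Kottwitz1986BaseChangeUnits, §1 pp. 240–241] -/
theorem glue_fixed_unit {σ : E →+* E} {ϖ : E} {d tE : ℕ} (hD : IsRamifiedQuadraticDatum σ ϖ d tE)
    (jE : E →+* M) (hjv : ∀ c, Valued.v (jE c) ≤ 1 ↔ Valued.v c ≤ 1) (hjfix : ∀ z, ρ z = z ↔ ∃ c, jE c = z) (hΘj : ∀ c, Θ (jE c) = jE (σ c))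
    (hρρ : ∀ x, ρ (ρ x) = x) (hvρ : ∀ x, Valued.v (ρ x) = Valued.v x) (hΘΘ : ∀ x, Θ (Θ x) = x) (hΘρ : ∀ x, Θ (ρ x) = ρ (Θ x))
    (hvΘ : ∀ x, Valued.v (Θ x) = Valued.v x)
    {hM : M} (hΘh : Θ hM = hM) (hh : hM ≠ 0) {j b : ℕ} (hb1 : 1 ≤ b) (hcc : jE ϖ ^ j * (α - ρ α) ≠ 0)
    (hFgap : ∀ z : M, ρ z = z → Θ z = z → Valued.v (jE ϖ) < Valued.v z → Valued.v z ≤ 1 → Valued.v z = 1)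
    {x₀ : M} (hx₀ : x₀ ≠ 0) (hyO : IsOrd ρ α (jE ϖ ^ j) (dualGen ρ Θ α (jE ϖ ^ j) hM x₀))
    (hyprim : ¬ IsOrd ρ α (jE ϖ ^ j) (dualGen ρ Θ α (jE ϖ ^ j) hM x₀ / jE ϖ)) (hylev : Valued.v (dualGen ρ Θ α (jE ϖ ^ j) hM x₀) = Valued.v (jE ϖ) ^ b)
    {hW : E} (hσhW : σ hW = hW) (hhW1 : Valued.v (jE hW) = 1)
    {r : E} (hr : jE r = glueUnit ρ Θ α (jE ϖ ^ j) hM (jE ϖ) (jE hW) x₀ b) :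
    σ r = r ∧ Valued.v r = 1 := by
  obtain ⟨-, -, hϖ, -⟩ := id hD
  have hvϖ0 : Valued.v ϖ ≠ 0 := by rw [hϖ]; exact exp_ne_zero
  have hϖ0 : ϖ ≠ 0 := fun h0 => by rw [h0, map_zero] at hvϖ0; exact hvϖ0 rfl
  have hϖ1 : Valued.v ϖ ≤ 1 := by rw [hϖ, ← exp_zero, exp_le_exp]; norm_num
  have hjϖ0 : jE ϖ ≠ 0 := (map_ne_zero jE).2 hϖ0
  have hjϖ1 : Valued.v (jE ϖ) ≤ 1 := (hjv ϖ).2 hϖ1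
  have hρj : ∀ c' : E, ρ (jE c') = jE c' := fun c' => (hjfix _).2 ⟨c', rfl⟩
  have hρcc : ρ (jE ϖ ^ j) = jE ϖ ^ j := by rw [map_pow, hρj]
  -- the vertex's letters: `t` doubly fixed unit
  obtain ⟨-, hΘt, ht1⟩ := F0P3cDyRamRowCellFibreTransport.trace_letters (α := α) hρρ hΘΘ hΘρ hΘh (hρj ϖ) hjϖ0 hjϖ1 hb1 hcc hFgap hyO hyprim hylev
  set A : M := α - ρ α with hAdef
  set u₀ : M := hM * (x₀ * Θ x₀) with hu₀def
  set t : M := u₀ + ρ u₀ with htdef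
  set ν : M := jE ϖ ^ j * A * Θ (jE ϖ ^ j * A) with hνdef
  set P : M := (jE ϖ * Θ (jE ϖ)) ^ b with hPdef
  have hP0 : P ≠ 0 := pow_ne_zero _ (mul_ne_zero hjϖ0 ((map_ne_zero Θ).2 hjϖ0))
  have hΘu : Θ u₀ = u₀ := by rw [hu₀def, map_mul, map_mul, hΘh, hΘΘ]; ring
  -- the glue unit in trace form
  have hr' : jE r = -(t / (u₀ * ρ u₀ * ν) * P / jE hW) := by
    rw [hr, glueUnit_eq_trace_form (α := α) hρρ hΘΘ hΘρ hρcc hΘh hh hx₀ hcc]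
  -- `σ r = r`
  have hΘr : Θ (jE r) = jE r := by
    have hΘν : Θ ν = ν := by rw [hνdef, map_mul, hΘΘ, mul_comm]
    have hΘP : Θ P = P := by rw [hPdef, map_pow, map_mul, hΘΘ, mul_comm]
    rw [hr', map_neg, map_div₀, map_mul, map_div₀, map_mul, map_mul, hΘt, hΘu, hΘρ, hΘu, hΘν, hΘP, hΘj, hσhW]
  refine ⟨jE.injective (by rw [← hΘj, hΘr]), ?_⟩
  -- `|r| = 1`
  have hr1M : Valued.v (jE r) = 1 := by
    have hY : dualGen ρ Θ α (jE ϖ ^ j) hM x₀ = u₀ * (jE ϖ ^ j * A) := by rw [dualGen_def]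
    have hu₀v : Valued.v u₀ * Valued.v (jE ϖ ^ j * A) = Valued.v (jE ϖ) ^ b := by rw [← Valuation.map_mul, ← hY, hylev]
    have hνv : Valued.v ν = Valued.v (jE ϖ ^ j * A) * Valued.v (jE ϖ ^ j * A) := by rw [hνdef, Valuation.map_mul, hvΘ]
    have hPv : Valued.v P = Valued.v (jE ϖ) ^ b * Valued.v (jE ϖ) ^ b := by rw [hPdef, Valuation.map_pow, Valuation.map_mul, hvΘ, mul_pow]
    have hden : Valued.v (u₀ * ρ u₀ * ν) = Valued.v P := by
      rw [Valuation.map_mul, Valuation.map_mul, hvρ, hνv, hPv, ← hu₀v]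
      simp only [mul_comm, mul_left_comm]
    rw [hr', Valuation.map_neg, map_div₀, Valuation.map_mul, map_div₀, ht1, hden, one_div, inv_mul_cancel₀ ((Valuation.ne_zero_iff _).2 hP0), hhW1, div_one]
  refine le_antisymm ((hjv r).1 hr1M.le) ?_
  have hr0 : r ≠ 0 := fun h0 => by rw [h0, map_zero, Valuation.map_zero] at hr1M; exact zero_ne_one hr1M
  have h1 : Valued.v r⁻¹ ≤ 1 := (hjv _).1 (by rw [map_inv₀, map_inv₀, hr1M, inv_one])
  rwa [map_inv₀, inv_le_one₀ (zero_lt_iff.2 ((Valuation.ne_zero_iff _).2 hr0))] at h1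

omit [Field M] [Valued M ℤᵐ⁰] in
/-- **POPULATED ⟺ THE GLUE VALUE IS AN `E∕F`-NORM** — the `E`-side population test: for a fixed unit `r` and `d ≤ b`, `#Sol_{2b}(r) ≠ 0 ⟺ r ∈ N(E^×)` (★ Lit norm-fibre values:
`2q^b` on norms, `0` off norms). [cite: Serre1979, Ch. V §3 Prop. 5, Cor. 2–3] [cite: Kottwitz1986BaseChangeUnits, §1 pp. 240–241] -/
theorem weight_ne_zero_iff_exists_norm [CompleteSpace E] [IsDiscreteValuationRing 𝒪[E]] [Finite 𝓀[E]]
    {σ : E →+* E} {ϖ : E} {d tE : ℕ} (hD : IsRamifiedQuadraticDatum σ ϖ d tE) (h2v : Valued.v (2 : E) < 1)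
    {b : ℕ} (hdb : d ≤ b) {r : E} (hσr : σ r = r) (hr1 : Valued.v r = 1) {f : ℕ}
    (hf : f = Nat.card {x : 𝒪[E] ⧸ 𝓂[E] ^ (2 * b) // ∃ u' : 𝒪[E], Ideal.Quotient.mk (𝓂[E] ^ (2 * b)) u' = x ∧ Valued.v ((u' : E) * σ u' - r) ≤ Valued.v (ϖ ^ (2 * b))}) :
    f ≠ 0 ↔ ∃ z : E, z * σ z = r := by
  classical
  rw [hf]
  constructor
  · intro hne
    by_contra hN
    exact hne (natCard_normFibre_eq_zero_of_not_exists_of_le hD hσr hr1 hN hdb)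
  · intro hN
    rw [natCard_normFibre_eq_two_mul_pow_of_exists hD h2v hr1 hN hdb]
    exact mul_ne_zero two_ne_zero (pow_ne_zero _ (Nat.card_pos (α := 𝓀[E])).ne')

/-! ## §3 HEAD — the population read -/
/-- **HEAD — «THE POPULATION READ OF A ROW VERTEX» (LH4-p19's COUNT SOCKET hypothesis (hP)).**  `E`-side: a wild ramified quadratic datum on a complete `E` with finite residue
field and `|2| < 1`; line model `jE : E → M` (`Fix ρ = jE(E)`, `Θ∘jE = jE∘σ`, `|jE c| ≤ 1 ↔ |c| ≤ 1`); `ρ, Θ` commuting involutive isometries; `Θh = h ≠ 0`; a vertex of the cell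
`(j, b)` (generator `x₀ ≠ 0`, `Y = dualGen ρ Θ α (jEϖ^j) h x₀` integral, Gram-primitive, of level `b ≥ d`, `1 ≤ b`; letter `hFgap`); the literal's line entry `h_W` (`σh_W = h_W`,
`|jE h_W| = 1`); the WEIGHT LETTER instantiated: `f = #Sol_{2b}(r)` with `jE r = glueUnit ρ Θ α (jEϖ^j) h (jEϖ) (jE h_W) x₀ b`; and the index-two letters (`c` doubly fixed, `c ∉ 𝒩`,
dichotomy).  THEN **`f ≠ 0 ⟺ (t ∈ 𝒩 ⟺ −N_ρ(h)·N_Θ(α − ρα)·jE h_W ∈ 𝒩)`**, `t = Tr_ρ(h·x₀Θx₀)`, `𝒩 = {eΘe : ρe = e}` — the populated class is ONE `E∕F`-class of the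
population scalar, a LITERAL constant. [cite: Kottwitz1986BaseChangeUnits, §1 pp. 240–241] [cite: Serre1979, Ch. V §3 Prop. 5, Cor. 2–3; Ch. XIV §6] [cite: Jacobowitz1962, §4]
[cite: LabesseLanglands1979, §2 p. 8] -/
theorem weight_ne_zero_iff_class [CompleteSpace E] [IsDiscreteValuationRing 𝒪[E]] [Finite 𝓀[E]]
    {σ : E →+* E} {ϖ : E} {d tE : ℕ} (hD : IsRamifiedQuadraticDatum σ ϖ d tE) (h2v : Valued.v (2 : E) < 1)
    (jE : E →+* M) (hjv : ∀ c, Valued.v (jE c) ≤ 1 ↔ Valued.v c ≤ 1) (hjfix : ∀ z, ρ z = z ↔ ∃ c, jE c = z) (hΘj : ∀ c, Θ (jE c) = jE (σ c))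
    (hρρ : ∀ x, ρ (ρ x) = x) (hvρ : ∀ x, Valued.v (ρ x) = Valued.v x) (hΘΘ : ∀ x, Θ (Θ x) = x) (hΘρ : ∀ x, Θ (ρ x) = ρ (Θ x))
    (hvΘ : ∀ x, Valued.v (Θ x) = Valued.v x)
    {hM : M} (hΘh : Θ hM = hM) (hh : hM ≠ 0) {j b : ℕ} (hb1 : 1 ≤ b) (hdb : d ≤ b) (hcc : jE ϖ ^ j * (α - ρ α) ≠ 0)
    (hFgap : ∀ z : M, ρ z = z → Θ z = z → Valued.v (jE ϖ) < Valued.v z → Valued.v z ≤ 1 → Valued.v z = 1)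
    {x₀ : M} (hx₀ : x₀ ≠ 0) (hyO : IsOrd ρ α (jE ϖ ^ j) (dualGen ρ Θ α (jE ϖ ^ j) hM x₀))
    (hyprim : ¬ IsOrd ρ α (jE ϖ ^ j) (dualGen ρ Θ α (jE ϖ ^ j) hM x₀ / jE ϖ)) (hylev : Valued.v (dualGen ρ Θ α (jE ϖ ^ j) hM x₀) = Valued.v (jE ϖ) ^ b)
    {hW : E} (hσhW : σ hW = hW) (hhW1 : Valued.v (jE hW) = 1)
    {f : ℕ} {r : E} (hr : jE r = glueUnit ρ Θ α (jE ϖ ^ j) hM (jE ϖ) (jE hW) x₀ b)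
    (hf : f = Nat.card {x : 𝒪[E] ⧸ 𝓂[E] ^ (2 * b) // ∃ u' : 𝒪[E], Ideal.Quotient.mk (𝓂[E] ^ (2 * b)) u' = x ∧ Valued.v ((u' : E) * σ u' - r) ≤ Valued.v (ϖ ^ (2 * b))})
    {c : M} (hρc : ρ c = c) (hΘc : Θ c = c) (hcn : ¬ ∃ e : M, ρ e = e ∧ e * Θ e = c)
    (hdich : ∀ u : M, ρ u = u → Θ u = u → u ≠ 0 → (∃ e : M, ρ e = e ∧ e * Θ e = u) ∨ ∃ e : M, ρ e = e ∧ e * Θ e = c * u) :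
    f ≠ 0 ↔ ((∃ e : M, ρ e = e ∧ e * Θ e = hM * (x₀ * Θ x₀) + ρ (hM * (x₀ * Θ x₀))) ↔
      ∃ e : M, ρ e = e ∧ e * Θ e = -(hM * ρ hM * ((α - ρ α) * Θ (α - ρ α)) * jE hW)) := by
  obtain ⟨-, -, hϖ, -⟩ := id hD
  have hvϖ0 : Valued.v ϖ ≠ 0 := by rw [hϖ]; exact exp_ne_zero
  have hϖ0 : ϖ ≠ 0 := fun h0 => by rw [h0, map_zero] at hvϖ0; exact hvϖ0 rfl
  have hϖ1 : Valued.v ϖ ≤ 1 := by rw [hϖ, ← exp_zero, exp_le_exp]; norm_num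
  have hjϖ0 : jE ϖ ≠ 0 := (map_ne_zero jE).2 hϖ0
  have hjϖ1 : Valued.v (jE ϖ) ≤ 1 := (hjv ϖ).2 hϖ1
  have hρj : ∀ c' : E, ρ (jE c') = jE c' := fun c' => (hjfix _).2 ⟨c', rfl⟩
  have hρcc : ρ (jE ϖ ^ j) = jE ϖ ^ j := by rw [map_pow, hρj]
  have hA0 : α - ρ α ≠ 0 := fun h0 => hcc (by rw [h0, mul_zero])
  -- the glue value is a fixed unit (§2); the vertex's letters: `t` doubly fixed unit
  obtain ⟨hσr, hr1⟩ := glue_fixed_unit (α := α) hD jE hjv hjfix hΘj hρρ hvρ hΘΘ hΘρ hvΘ hΘh hh hb1 hcc hFgap hx₀ hyO hyprim hylev hσhW hhW1 hr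
  obtain ⟨hρt, hΘt, ht1⟩ := F0P3cDyRamRowCellFibreTransport.trace_letters (α := α) hρρ hΘΘ hΘρ hΘh (hρj ϖ) hjϖ0 hjϖ1 hb1 hcc hFgap hyO hyprim hylev
  set A : M := α - ρ α with hAdef
  set u₀ : M := hM * (x₀ * Θ x₀) with hu₀def
  set t : M := u₀ + ρ u₀ with htdef
  set ν : M := jE ϖ ^ j * A * Θ (jE ϖ ^ j * A) with hνdef
  set P : M := (jE ϖ * Θ (jE ϖ)) ^ b with hPdef
  have ht0 : t ≠ 0 := fun h0 => by rw [h0, map_zero] at ht1; exact zero_ne_one ht1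
  have hΘx₀ : Θ x₀ ≠ 0 := (map_ne_zero Θ).2 hx₀
  have hu₀0 : u₀ ≠ 0 := mul_ne_zero hh (mul_ne_zero hx₀ hΘx₀)
  have hρu₀0 : ρ u₀ ≠ 0 := (map_ne_zero ρ).2 hu₀0
  have hν0 : ν ≠ 0 := mul_ne_zero hcc ((map_ne_zero Θ).2 hcc)
  have hjhW0 : jE hW ≠ 0 := fun h0 => by rw [h0, map_zero] at hhW1; exact zero_ne_one hhW1
  have hP0 : P ≠ 0 := pow_ne_zero _ (mul_ne_zero hjϖ0 ((map_ne_zero Θ).2 hjϖ0))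
  -- the glue unit in trace form
  have hr' : jE r = -(t / (u₀ * ρ u₀ * ν) * P / jE hW) := by
    rw [hr, glueUnit_eq_trace_form (α := α) hρρ hΘΘ hΘρ hρcc hΘh hh hx₀ hcc]
  -- E-side: `f ≠ 0 ⟺ r ∈ N(E^×)` (★ Lit, `d ≤ b`), then transfer to `M`
  rw [weight_ne_zero_iff_exists_norm hD h2v hdb hσr hr1 hf, ← fixedNorm_map_iff jE hjfix hΘj r, hr']
  -- class calculus: `jE r = (t·K)·W` with `W ∈ 𝒩`, `K = −(N_ρ h · N_Θ A · jE h_W)⁻¹`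
  set X : M := hM * ρ hM * (A * Θ A) * jE hW with hXdef
  have hρhM0 : ρ hM ≠ 0 := (map_ne_zero ρ).2 hh
  have hΘA0 : Θ A ≠ 0 := (map_ne_zero Θ).2 hA0
  have hX0 : X ≠ 0 := mul_ne_zero (mul_ne_zero (mul_ne_zero hh hρhM0) (mul_ne_zero hA0 hΘA0)) hjhW0
  have hρA : ρ A = -A := by rw [hAdef, map_sub, hρρ]; ring
  have hρX : ρ X = X := by
    rw [hXdef, map_mul, map_mul, map_mul, map_mul, hρρ, hρA, ← hΘρ, hρA, map_neg, hρj]; ring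
  have hΘX : Θ X = X := by
    rw [hXdef, map_mul, map_mul, map_mul, map_mul, hΘh, hΘρ, hΘh, hΘΘ, hΘj, hσhW]; ring
  set W : M := P * ((x₀ * ρ x₀) * Θ (x₀ * ρ x₀))⁻¹ * (jE ϖ ^ j * Θ (jE ϖ ^ j))⁻¹ with hWdef
  have hNx : (x₀ * ρ x₀) * Θ (x₀ * ρ x₀) ≠ 0 :=
    mul_ne_zero (mul_ne_zero hx₀ ((map_ne_zero ρ).2 hx₀)) ((map_ne_zero Θ).2 (mul_ne_zero hx₀ ((map_ne_zero ρ).2 hx₀)))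
  have hcc0 : jE ϖ ^ j ≠ 0 := pow_ne_zero _ hjϖ0
  have hNc : jE ϖ ^ j * Θ (jE ϖ ^ j) ≠ 0 := mul_ne_zero hcc0 ((map_ne_zero Θ).2 hcc0)
  have hW0 : W ≠ 0 := mul_ne_zero (mul_ne_zero hP0 (inv_ne_zero hNx)) (inv_ne_zero hNc)
  have hWN : ∃ e : M, ρ e = e ∧ e * Θ e = W := by
    refine fixedNorm_mul (fixedNorm_mul ?_ (fixedNorm_inv (fixedNorm_normTheta_normRho hρρ x₀))) (fixedNorm_inv ⟨jE ϖ ^ j, hρcc, rfl⟩)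
    exact ⟨jE ϖ ^ b, by rw [map_pow, hρj], by rw [hPdef, map_pow, ← mul_pow]⟩
  have hu₀ρ : u₀ * ρ u₀ = hM * ρ hM * ((x₀ * ρ x₀) * Θ (x₀ * ρ x₀)) := by
    rw [hu₀def, map_mul ρ hM, ← normTheta_mul_map_normTheta hΘρ x₀]; ring
  have hνsplit : ν = (jE ϖ ^ j * Θ (jE ϖ ^ j)) * (A * Θ A) := by rw [hνdef, map_mul]; ring
  have hfact : -(t / (u₀ * ρ u₀ * ν) * P / jE hW) = (t * (-X⁻¹)) * W := by
    rw [hu₀ρ, hνsplit, hXdef, hWdef]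
    field_simp
  rw [hfact, fixedNorm_mul_iff hW0 hWN, fixedNorm_mul_iff_iff hρc hΘc hcn hdich hρt hΘt ht0 (by rw [map_neg, map_inv₀, hρX])
    (by rw [map_neg, map_inv₀, hΘX]) (neg_ne_zero.2 (inv_ne_zero hX0))]
  -- `−X⁻¹ ∈ 𝒩 ⟺ −X ∈ 𝒩`
  have hlast : (∃ e : M, ρ e = e ∧ e * Θ e = -X⁻¹) ↔ ∃ e : M, ρ e = e ∧ e * Θ e = -X := by
    rw [show -X⁻¹ = (-X)⁻¹ by rw [inv_neg]]
    exact ⟨fun h => by simpa using fixedNorm_inv h, fun h => fixedNorm_inv h⟩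
  rw [hlast]

/-! ## §4 The pairing sign on the populated class (LH4-p19 (g2)'s (hL) link with ★ `…RowVertexAffineSignLabel`) -/
/-- **HEAD 2 — «ON THE POPULATED CLASS THE PAIRING SIGN IS THE LITERAL CONSTANT `ω(−h_W)`».**  Frame of HEAD (without the index-two letters) plus the glue letter
`D₀⁻¹ + ρD₀⁻¹ = jE pw` (`D₀ = cc(α − ρα)·ΘY`; ★ `inv_add_map_inv_eq_map_pairing`: `pw = ⟨w₀, w₀⟩`, `φ w₀ = Y⁻¹x₀`).  THEN **`f ≠ 0 ⟺ normSign σ (pw·(ϖσϖ)^b) = normSign σ (−h_W)`**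
(`pw·(ϖσϖ)^b = −h_W·r`, `ω` multiplicative on fixed non-zero elements, `ω(r) = 1 ⟺ r ∈ N(E^×) ⟺ f ≠ 0`).  So on populated vertices ★ p863628's label test
`normSign σ (pw·(ϖσϖ)^b)·normSign σ (α₁ + γ₁V) = 1` reads `normSign σ (α₁ + γ₁V) = normSign σ (−h_W)` (`normSign_mul_eq_one_iff_eq` below) — LH4-p19's `ψ` with the literal constant
`s₀ = ω(−h_W)`. [cite: Kottwitz1986BaseChangeUnits, §1 pp. 240–241] [cite: Serre1979, Ch. V §3 Cor. 3; Ch. XV §2] [cite: Rogawski1990, §4.9 Prop. 4.9.1 (b) p. 55] -/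
theorem weight_ne_zero_iff_normSign_pairing [CompleteSpace E] [IsDiscreteValuationRing 𝒪[E]] [Finite 𝓀[E]]
    {σ : E →+* E} {ϖ : E} {d tE : ℕ} (hD : IsRamifiedQuadraticDatum σ ϖ d tE) (h2v : Valued.v (2 : E) < 1)
    (jE : E →+* M) (hjv : ∀ c, Valued.v (jE c) ≤ 1 ↔ Valued.v c ≤ 1) (hjfix : ∀ z, ρ z = z ↔ ∃ c, jE c = z) (hΘj : ∀ c, Θ (jE c) = jE (σ c))
    (hρρ : ∀ x, ρ (ρ x) = x) (hvρ : ∀ x, Valued.v (ρ x) = Valued.v x) (hΘΘ : ∀ x, Θ (Θ x) = x) (hΘρ : ∀ x, Θ (ρ x) = ρ (Θ x))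
    (hvΘ : ∀ x, Valued.v (Θ x) = Valued.v x)
    {hM : M} (hΘh : Θ hM = hM) (hh : hM ≠ 0) {j b : ℕ} (hb1 : 1 ≤ b) (hdb : d ≤ b) (hcc : jE ϖ ^ j * (α - ρ α) ≠ 0)
    (hFgap : ∀ z : M, ρ z = z → Θ z = z → Valued.v (jE ϖ) < Valued.v z → Valued.v z ≤ 1 → Valued.v z = 1)
    {x₀ : M} (hx₀ : x₀ ≠ 0) (hyO : IsOrd ρ α (jE ϖ ^ j) (dualGen ρ Θ α (jE ϖ ^ j) hM x₀))
    (hyprim : ¬ IsOrd ρ α (jE ϖ ^ j) (dualGen ρ Θ α (jE ϖ ^ j) hM x₀ / jE ϖ)) (hylev : Valued.v (dualGen ρ Θ α (jE ϖ ^ j) hM x₀) = Valued.v (jE ϖ) ^ b)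
    {hW : E} (hσhW : σ hW = hW) (hhW1 : Valued.v (jE hW) = 1) {pw : E}
    (hTr : (jE ϖ ^ j * (α - ρ α) * Θ (dualGen ρ Θ α (jE ϖ ^ j) hM x₀))⁻¹ + ρ (jE ϖ ^ j * (α - ρ α) * Θ (dualGen ρ Θ α (jE ϖ ^ j) hM x₀))⁻¹ = jE pw)
    {f : ℕ} {r : E} (hr : jE r = glueUnit ρ Θ α (jE ϖ ^ j) hM (jE ϖ) (jE hW) x₀ b)
    (hf : f = Nat.card {x : 𝒪[E] ⧸ 𝓂[E] ^ (2 * b) // ∃ u' : 𝒪[E], Ideal.Quotient.mk (𝓂[E] ^ (2 * b)) u' = x ∧ Valued.v ((u' : E) * σ u' - r) ≤ Valued.v (ϖ ^ (2 * b))}) :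
    f ≠ 0 ↔ normSign σ (pw * (ϖ * σ ϖ) ^ b) = normSign σ (-hW) := by
  obtain ⟨hσr, hr1⟩ := glue_fixed_unit (α := α) hD jE hjv hjfix hΘj hρρ hvρ hΘΘ hΘρ hvΘ hΘh hh hb1 hcc hFgap hx₀ hyO hyprim hylev hσhW hhW1 hr
  have hr0 : r ≠ 0 := fun h0 => by rw [h0, Valuation.map_zero] at hr1; exact zero_ne_one hr1
  have hhW0 : hW ≠ 0 := fun h0 => by rw [h0, map_zero, Valuation.map_zero] at hhW1; exact zero_ne_one hhW1
  rw [weight_ne_zero_iff_exists_norm hD h2v hdb hσr hr1 hf, pairing_mul_normPow_eq (α := α) jE hΘj hhW0 hTr hr,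
    normSign_mul_of_fixed hD (by rw [map_neg, hσhW]) hσr (neg_ne_zero.2 hhW0) hr0]
  have hω0 : normSign σ (-hW) ≠ 0 := by unfold normSign; split_ifs <;> decide
  constructor
  · intro hN; rw [normSign_of_isNorm σ hN, mul_one]
  · intro h
    by_contra hN
    rw [normSign_of_not_isNorm σ hN] at h
    omega

omit [Valued E ℤᵐ⁰] in
/-- Sign bookkeeping for the consumer: with `ω(x) = c` (`c = ω(−h_W)` on the populated class, HEAD 2), `ω(x)·ω(g) = 1 ⟺ ω(g) = c` (`ω` takes the values `±1`).
[cite: Rogawski1990, §4.9 p. 55] -/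
theorem normSign_mul_eq_one_iff_eq {σ : E →+* E} {x : E} {c : ℤ} (hx : normSign σ x = c) (g : E) :
    normSign σ x * normSign σ g = 1 ↔ normSign σ g = c := by
  subst hx
  have h1 : normSign σ x = 1 ∨ normSign σ x = -1 := by unfold normSign; split_ifs <;> simp
  have h2 : normSign σ g = 1 ∨ normSign σ g = -1 := by unfold normSign; split_ifs <;> simp
  rcases h1 with h1 | h1 <;> rcases h2 with h2 | h2 <;> simp [h1, h2]

end Summit.HodgeConjecture.HodgeConjecture.Cruxes.H413.F0P3cDyRamRowVertexPopulationRead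

end
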